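import Literature.AlgebraicGeometry.Frobenioids.Monoids
import Mathlib.GroupTheory.OrderOfElement
import Mathlib.Algebra.Group.TypeTags.Basic
import Mathlib.Data.ZMod.Defs
import HarnessLib

/-!
# Frobenioids I, §0 "Monoids": *torsion-free* and *characteristically injective* — Mathlib bindings,
# instance witnesses, and the kernel status of the two predicates as FACT-LIST rows

Mochizuki, *The geometry of Frobenioids I: the general theory*, Kyushu J. Math. **62** (2008)
293–400, §0 "Monoids", kurims text p. 11 [cite: MochizukiFrdI2008, §0 p.11]:

  "We shall say that `M` is *torsion-free* if `M` has no torsion elements";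
  "we shall say that [a morphism of monoids `M₁ → M₂`] is *characteristically injective* if it is
  injective and, moreover, induces an injection `M₁^char ↪ M₂^char`".

Both are DEFINITIONS of `Monoids.lean` (`IsTorsionFree M`, a `structure … : Prop`;
`IsCharInjective φ := Injective φ ∧ Injective (associatesMap φ)`), i.e. HYPOTHESIS PREDICATES that the
paper switches on per sentence — not closed published facts.  PROOF-ONLY companion (abc-iut cell, block F
fact-proving wave, FACT-LIST rows F-2361 `IsTorsionFree` and F-1124 `IsCharInjective`, tranche 42): it
records, in kernel,

* the Mathlib bindings: `IsTorsionFree M ↔ ∀ a, IsOfFinOrder a → a = 1`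
  (`isTorsionFree_iff_eq_one_of_isOfFinOrder`); Mathlib's `IsMulTorsionFree M` (injective power maps)
  implies it (`IsTorsionFree.of_isMulTorsionFree`) and is EQUIVALENT to it on commutative groups
  (`isTorsionFree_iff_isMulTorsionFree`); char-injectivity of identities, isomorphisms and composites
  (the instance form the cell's consumers use — an injection into a SHARP monoid is characteristically
  injective — is already landed: `isCharInjective_of_injective_of_isSharp`, `PadicFrobenioidZeroMonoid.lean`,
  and `isCharInjective_of_injective_of_isSharp_target`, `PerfectionPreFrobenioid.lean`; not restated);
* instance witnesses: `(ℕ, +)` is torsion-free; the identity is characteristically injective;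
* that the UNIVERSAL CLOSURES of the two rows are FALSE as typed (so the rows are schemata, consumable
  only in instance form — refuting OUR universal closure is not a statement about print):
  `ZMod 3` (multiplicatively) is not torsion-free (`2 ^ 2 = 1`, `2 ≠ 1`); the trivial homomorphism
  `(ℕ, +) → (ℕ, +)` is not characteristically injective; and — showing that the second clause of the
  definition is not redundant — the INJECTIVE inclusion `(ℕ, +) ↪ (ℤ, +)` is not characteristically
  injective (`ℤ^char = 0` while `ℕ^char = ℕ`).

No statement of the paper is strengthened; nothing here is specific to the abc programme.
-/

namespace Literature.AlgebraicGeometry.Frobenioids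

open Function

universe u

variable {M : Type u} [CommMonoid M]

/-! ### `IsTorsionFree`: bindings and witnesses (FACT-LIST F-2361) -/

/-- Binding to Mathlib's order vocabulary: `M` is torsion-free in the sense of FrdI §0 p. 11 iff every
element of finite order is trivial. [cite: MochizukiFrdI2008, §0 p.11] -/
theorem isTorsionFree_iff_eq_one_of_isOfFinOrder :
    IsTorsionFree M ↔ ∀ a : M, IsOfFinOrder a → a = 1 := by
  rw [isTorsionFree_iff]
  refine ⟨fun h a ha => ?_, fun h a n hn han => h a (isOfFinOrder_iff_pow_eq_one.mpr ⟨n, hn, han⟩)⟩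
  obtain ⟨n, hn, han⟩ := isOfFinOrder_iff_pow_eq_one.mp ha
  exact h a n hn han

/-- Mathlib's `IsMulTorsionFree` (every power map `a ↦ a ^ n`, `n ≠ 0`, injective) implies torsion-free
in the sense of FrdI §0 p. 11. (The converse fails for general commutative monoids: torsion-freeness of
`M` does not make `M^gp` torsion-free.) [cite: MochizukiFrdI2008, §0 p.11] -/
theorem IsTorsionFree.of_isMulTorsionFree [IsMulTorsionFree M] : IsTorsionFree M :=
  ⟨fun _a _n hn han => (pow_eq_one_iff_left hn.ne').mp han⟩

/-- On a commutative GROUP the two notions coincide: torsion-free (FrdI §0 p. 11) iff Mathlib's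
`IsMulTorsionFree`. [cite: MochizukiFrdI2008, §0 p.11] -/
theorem isTorsionFree_iff_isMulTorsionFree {G : Type u} [CommGroup G] :
    IsTorsionFree G ↔ IsMulTorsionFree G := by
  rw [isMulTorsionFree_iff_not_isOfFinOrder, isTorsionFree_iff_eq_one_of_isOfFinOrder]
  exact ⟨fun h a ha hfin => ha (h a hfin), fun h a hfin => by_contra fun ha => h ha hfin⟩

/-- A torsion-free monoid has no non-trivial element of finite order (dot-notation form of the
binding). [cite: MochizukiFrdI2008, §0 p.11] -/
theorem IsTorsionFree.eq_one_of_isOfFinOrder (h : IsTorsionFree M) {a : M} (ha : IsOfFinOrder a) :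
    a = 1 :=
  isTorsionFree_iff_eq_one_of_isOfFinOrder.mp h a ha

/-- The trivial monoid is torsion-free. [cite: MochizukiFrdI2008, §0 p.11] -/
theorem isTorsionFree_of_subsingleton [Subsingleton M] : IsTorsionFree M :=
  ⟨fun a _ _ _ => Subsingleton.elim a 1⟩

/-- Instance witness: the divisor monoid `(ℕ, +)` (written multiplicatively) is torsion-free.
[cite: MochizukiFrdI2008, §0 p.11] -/
theorem isTorsionFree_multiplicative_nat : IsTorsionFree (Multiplicative ℕ) :=
  IsTorsionFree.of_isMulTorsionFree

/-- Instance witness: `(ℤ, +)` (written multiplicatively) is torsion-free.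
[cite: MochizukiFrdI2008, §0 p.11] -/
theorem isTorsionFree_multiplicative_int : IsTorsionFree (Multiplicative ℤ) :=
  IsTorsionFree.of_isMulTorsionFree

/-- `ZMod 3`, as a multiplicative commutative monoid, is NOT torsion-free: `2 ^ 2 = 1` and `2 ≠ 1`.
[cite: MochizukiFrdI2008, §0 p.11] -/
theorem not_isTorsionFree_zmod_three : ¬ IsTorsionFree (ZMod 3) := fun h =>
  absurd (h.eq_one_of_pow_eq_one 2 2 two_pos (by decide)) (by decide)

/-- **The universal closure of FACT-LIST row F-2361 is false**: "every commutative monoid is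
torsion-free" fails at `ZMod 3`.  `IsTorsionFree` is a hypothesis predicate (FrdI §0 p. 11), consumable
only in instance form; this refutes OUR universal closure, not a statement of the paper.
[cite: MochizukiFrdI2008, §0 p.11] -/
theorem not_forall_isTorsionFree : ¬ ∀ (M : Type) [CommMonoid M], IsTorsionFree M := fun h =>
  not_isTorsionFree_zmod_three (h (ZMod 3))

/-! ### `IsCharInjective`: bindings and witnesses (FACT-LIST F-1124) -/

section CharInjective

variable {N : Type u} [CommMonoid N] {P : Type u} [CommMonoid P]

/-- `associatesMap` of the identity is the identity. [cite: MochizukiFrdI2008, §0 p.11] -/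
theorem associatesMap_id_apply (x : Associates M) : associatesMap (MonoidHom.id M) x = x := by
  obtain ⟨a, rfl⟩ := Associates.mk_surjective x
  rfl

/-- `associatesMap` is functorial: `(ψ ∘ φ)^char = ψ^char ∘ φ^char`. [cite: MochizukiFrdI2008, §0 p.11] -/
theorem associatesMap_comp_apply (φ : M →* N) (ψ : N →* P) (x : Associates M) :
    associatesMap (ψ.comp φ) x = associatesMap ψ (associatesMap φ x) := by
  obtain ⟨a, rfl⟩ := Associates.mk_surjective x
  rfl

/-- The identity is characteristically injective. [cite: MochizukiFrdI2008, §0 p.11] -/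
theorem isCharInjective_id : IsCharInjective (MonoidHom.id M) :=
  ⟨injective_id, fun x y h => by rwa [associatesMap_id_apply, associatesMap_id_apply] at h⟩

/-- Characteristically injective morphisms compose. [cite: MochizukiFrdI2008, §0 p.11] -/
theorem IsCharInjective.comp {φ : M →* N} {ψ : N →* P} (hψ : IsCharInjective ψ)
    (hφ : IsCharInjective φ) : IsCharInjective (ψ.comp φ) :=
  ⟨hψ.1.comp hφ.1, fun x y h => hφ.2 (hψ.2 (by
    rwa [associatesMap_comp_apply, associatesMap_comp_apply] at h))⟩

/-- An isomorphism of monoids is characteristically injective. [cite: MochizukiFrdI2008, §0 p.11] -/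
theorem isCharInjective_mulEquiv (e : M ≃* N) : IsCharInjective (e : M →* N) := by
  refine ⟨e.injective, fun x y h => ?_⟩
  obtain ⟨a, rfl⟩ := Associates.mk_surjective x
  obtain ⟨b, rfl⟩ := Associates.mk_surjective y
  rw [associatesMap_mk, associatesMap_mk, Associates.mk_eq_mk_iff_associated] at h
  obtain ⟨u, hu⟩ := h
  rw [Associates.mk_eq_mk_iff_associated]
  refine ⟨Units.map (e.symm : N →* M) u, e.injective ?_⟩
  rw [map_mul, Units.coe_map, MonoidHom.coe_coe, MulEquiv.apply_symm_apply]
  exact hu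

/-- The trivial homomorphism `(ℕ, +) → (ℕ, +)` is not characteristically injective (it is not even
injective: `0 ↦ 0`, `1 ↦ 0`). [cite: MochizukiFrdI2008, §0 p.11] -/
theorem not_isCharInjective_one_nat :
    ¬ IsCharInjective (1 : Multiplicative ℕ →* Multiplicative ℕ) := fun h =>
  absurd (@h.1 (Multiplicative.ofAdd 0) (Multiplicative.ofAdd 1) rfl) (by decide)

/-- The inclusion `(ℕ, +) ↪ (ℤ, +)`, multiplicatively (`AddMonoidHom.toMultiplicative (Nat.castAddMonoidHom ℤ)`),
is injective … [cite: MochizukiFrdI2008, §0 p.11] -/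
theorem natCast_toMultiplicative_injective :
    Injective (AddMonoidHom.toMultiplicative (Nat.castAddMonoidHom ℤ)) := fun a b h => by
  have h' : ((Multiplicative.toAdd a : ℕ) : ℤ) = (Multiplicative.toAdd b : ℕ) :=
    congrArg Multiplicative.toAdd h
  exact Multiplicative.toAdd.injective (Nat.cast_injective h')

/-- … but NOT characteristically injective: `ℤ` is a group, so `ℤ^char` is trivial, whereas `1 ∈ ℕ` is
not a unit, so `ℕ^char → ℤ^char` identifies the classes of `0` and `1`.  Hence the second clause of the
definition of "characteristically injective" (FrdI §0 p. 11) is not a consequence of the first.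
[cite: MochizukiFrdI2008, §0 p.11] -/
theorem not_isCharInjective_natCast_toMultiplicative :
    ¬ IsCharInjective (AddMonoidHom.toMultiplicative (Nat.castAddMonoidHom ℤ)) := by
  rintro ⟨-, h⟩
  have h1 : associatesMap (AddMonoidHom.toMultiplicative (Nat.castAddMonoidHom ℤ))
        (Associates.mk (Multiplicative.ofAdd 1)) =
      associatesMap (AddMonoidHom.toMultiplicative (Nat.castAddMonoidHom ℤ))
        (Associates.mk (Multiplicative.ofAdd 0)) := by
    rw [associatesMap_mk, associatesMap_mk, Associates.mk_eq_mk_iff_associated]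
    exact (associated_one_iff_isUnit.mpr (Group.isUnit _)).trans
      (associated_one_iff_isUnit.mpr (Group.isUnit _)).symm
  obtain ⟨u, hu⟩ := Associates.mk_eq_mk_iff_associated.mp (h h1)
  have hu' : (1 : ℕ) + Multiplicative.toAdd (u : Multiplicative ℕ) = 0 := congrArg Multiplicative.toAdd hu
  omega

/-- **The universal closure of FACT-LIST row F-1124 is false**: "every morphism of commutative monoids
is characteristically injective" fails at the trivial endomorphism of `(ℕ, +)` (and, for injective
morphisms, at `(ℕ, +) ↪ (ℤ, +)`).  `IsCharInjective` is a hypothesis predicate (FrdI §0 p. 11),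
consumable only in instance form; this refutes OUR universal closure, not a statement of the paper.
[cite: MochizukiFrdI2008, §0 p.11] -/
theorem not_forall_isCharInjective :
    ¬ ∀ (M N : Type) [CommMonoid M] [CommMonoid N] (φ : M →* N), IsCharInjective φ := fun h =>
  not_isCharInjective_one_nat (h _ _ 1)

/-- Even restricted to INJECTIVE morphisms the closure is false. [cite: MochizukiFrdI2008, §0 p.11] -/
theorem not_forall_isCharInjective_of_injective :
    ¬ ∀ (M N : Type) [CommMonoid M] [CommMonoid N] (φ : M →* N), Injective φ → IsCharInjective φ :=
  fun h => not_isCharInjective_natCast_toMultiplicative (h _ _ _ natCast_toMultiplicative_injective)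

end CharInjective

end Literature.AlgebraicGeometry.Frobenioids
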